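import Summits.CriticalPhenomena.PercolationContinuityZ3.Theorems.PercNearOneGluingNoHeavyLowerTailSahiSlotPatternSaturationColouring
import Summits.CriticalPhenomena.PercolationContinuityZ3.Theorems.PercNearOneGluingNoHeavyLowerTailSahiSlotPatternTwo
import Summits.CriticalPhenomena.PercolationContinuityZ3.Theorems.PercNearOneGluingNoHeavyLowerTailSahiGridPattern
import Summits.CriticalPhenomena.PercolationContinuityZ3.Theorems.PercNearOneGluingNoHeavyLowerTailSahiSlotPatternCombComparable

/-!
# Every order-3 cell `(d,3)` = `PatternPos d` reduced to ONE finite check over 3-coloured antichains of `[3]^d`; the cell `(4,3)`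

Support file (cell `prim-sahi`, literature seat `prim-sahi-lit` gen 50, staged for a prover; `--supports stmt-CriticalPhenomena-4575`).
Pure proofs, no definitions, no `sorry`, standard axioms.  A specialisation of typer gen 27's coloured-antichain normal form
(`SahiSlot.slotPatternPos_of_colouring'`, …`SahiSlotPatternSaturationColouring`) to ORDER THREE, where the lower cells `(d,1)`, `(d,2)` are
theorems for every `d` (`slotPatternPos_one`, `slotPatternPos_two`), so the reduction is UNCONDITIONAL in every dimension:

  `PatternPos d ⟸ (★₃,d)  ∀ N ⊆ [3]^d antichain, ∀ c : [3]^d → Fin 3, 0 ≤ patternForm d 3 (i ↦ 1_{ {q | ∀ p ∈ N, c p = i → ¬ q ≤ p} })`.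

At `d = 4` the statement `(★₃,4)` ranges over the `17 792 748` antichains of `[3]^4` (`Σ_N 3^{|N|} = 1 333 122 350 896` ordered colourings;
`763 864` antichains up to the axis group, `10 597 436 737` colourings up to axis and colour symmetry) and was verified exhaustively OUTSIDE the
kernel by two independent exact programs (typer gen 27 `satgen.c`, kit j166570–j166577; literature seat gen 50 `sat43_lit.c`): `0` negative values.
Nothing in this file asserts `(★₃,4)`; the `d = 4` declarations are implications, giving `PatternPos 4` (prim-sahi-p1's cell `(4,3)`, hitherto
certified by `763 864` LP slice certificates) a second, certificate-free finite normal form.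

* the lower cells `(d,1)`, `(d,2)` are `slotPatternPos_of_le_two'` (…`SahiSlotPatternCombComparable`, prim-masterthm-p3 gen 18);
* **`slotPatternPos_three_of_colouring₃`** — `(★₃,d) → SlotPatternPos d 3`, every `d`;
* **`patternPos_of_colouring₃`** — `(★₃,d) → PatternPos d`, every `d`;
* `patternPos_four_of_colouring₃`, `liebSahi_grid_four_of_colouring₃` (C₃ for every product weight on every 4-dimensional grid),
  `fkg_grid_four_of_colouring₃`, `liebSahiContinuum_four_three_of_colouring₃` (Lieb–Sahi on `[0,1]^4` at order 3) — the cell `(4,3)`. [this work]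
Landing note (prover seat prover-prim-nh-dp-fatminority gen 282): landed from the literature seat's staged file (sha256 242894a6…) with ONE delta
forced by the gate (`dedup.landed`): the staged local lemma `slotPatternPos_le_two'` restated the landed
`SahiSlot.slotPatternPos_of_le_two'` (…`SahiSlotPatternCombComparable` :109), so that module is imported and the landed lemma is used in
`slotPatternPos_three_of_colouring₃`; the other six declarations are byte-identical to the staged file.
-/

namespace Summit.CriticalPhenomena.PercolationContinuityZ3.Theorems

open Finset Function
open Literature.Combinatorics.Sahi2008

namespace SahiSlot

section OrderThree

open scoped Classical

variable {d : ℕ}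

/-- **ORDER THREE, EVERY DIMENSION**: `SlotPatternPos d 3` follows from the nonnegativity of `patternForm d 3` on the families co-generated by
the 3-coloured antichains of `[3]^d` — unconditionally (the head-slot sign law at order 3 needs only the cells `(d,1)`, `(d,2)`). [this work] -/
theorem slotPatternPos_three_of_colouring₃
    (h : ∀ (N : Finset (Q d 3)) (c : Q d 3 → Fin 3), IsAntichain (· ≤ ·) (N : Set (Q d 3)) →
      0 ≤ patternForm d 3 (fun i => setInd (univ.filter fun q : Q d 3 => ∀ p ∈ N, c p = i → ¬ q ≤ p))) :
    SlotPatternPos d 3 :=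
  slotPatternPos_of_colouring' (fun k hk1 hk2 => slotPatternPos_of_le_two' d k hk1 hk2) h

/-- **`PatternPos d` from the coloured-antichain check `(★₃,d)`** (prim-sahi's order-3 obligation, `slotPatternPos_three_iff_patternPos`). [this work] -/
theorem patternPos_of_colouring₃
    (h : ∀ (N : Finset (Q d 3)) (c : Q d 3 → Fin 3), IsAntichain (· ≤ ·) (N : Set (Q d 3)) →
      0 ≤ patternForm d 3 (fun i => setInd (univ.filter fun q : Q d 3 => ∀ p ∈ N, c p = i → ¬ q ≤ p))) :
    SahiGridPattern.PatternPos d :=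
  slotPatternPos_three_iff_patternPos.1 (slotPatternPos_three_of_colouring₃ h)

/-! ### The cell `(4,3)`: one finite statement on `[3]^4` -/

/-- **`PatternPos 4` FROM ONE FINITE CHECK**: the cell `(4,3)` follows from the nonnegativity of `patternForm 4 3` on the `1 333 122 350 896` ordered
3-colourings of the `17 792 748` antichains of `[3]^4` (verified outside the kernel by two independent exact engines; NOT asserted here). [this work] -/
theorem patternPos_four_of_colouring₃
    (h : ∀ (N : Finset (Q 4 3)) (c : Q 4 3 → Fin 3), IsAntichain (· ≤ ·) (N : Set (Q 4 3)) →
      0 ≤ patternForm 4 3 (fun i => setInd (univ.filter fun q : Q 4 3 => ∀ p ∈ N, c p = i → ¬ q ≤ p))) :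
    SahiGridPattern.PatternPos 4 :=
  patternPos_of_colouring₃ h

/-- From `(★₃,4)`: every product probability weight on every grid `[K+1]^4` is Sahi-positive of order 3. [this work] -/
theorem liebSahi_grid_four_of_colouring₃
    (h : ∀ (N : Finset (Q 4 3)) (c : Q 4 3 → Fin 3), IsAntichain (· ≤ ·) (N : Set (Q 4 3)) →
      0 ≤ patternForm 4 3 (fun i => setInd (univ.filter fun q : Q 4 3 => ∀ p ∈ N, c p = i → ¬ q ≤ p))) :
    ∀ (K : ℕ) (g : Fin 4 → Fin (K + 1) → ℝ), (∀ i u, 0 ≤ g i u) → (∀ i, ∑ u, g i u = 1) →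
      SahiPositive (fun ω : Fin 4 → Fin (K + 1) => ∏ i, g i (ω i)) 3 :=
  SahiGridPattern.liebSahi_grid_of_patternPos (patternPos_four_of_colouring₃ h)

/-- From `(★₃,4)`: every FKG probability weight on every grid `[b+1]^4` is Sahi-positive of order 3. [this work] -/
theorem fkg_grid_four_of_colouring₃
    (h : ∀ (N : Finset (Q 4 3)) (c : Q 4 3 → Fin 3), IsAntichain (· ≤ ·) (N : Set (Q 4 3)) →
      0 ≤ patternForm 4 3 (fun i => setInd (univ.filter fun q : Q 4 3 => ∀ p ∈ N, c p = i → ¬ q ≤ p))) :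
    ∀ (b : ℕ) (μ : (Fin 4 → Fin (b + 1)) → ℝ), IsFKGMeasure μ → SahiPositive μ 3 :=
  SahiGridPattern.fkg_grid_of_patternPos (patternPos_four_of_colouring₃ h)

/-- From `(★₃,4)`: Lieb–Sahi's Conjecture 1.1 on `[0,1]^4` at order 3 (Lebesgue measure, monotone functions). [this work] -/
theorem liebSahiContinuum_four_three_of_colouring₃
    (h : ∀ (N : Finset (Q 4 3)) (c : Q 4 3 → Fin 3), IsAntichain (· ≤ ·) (N : Set (Q 4 3)) →
      0 ≤ patternForm 4 3 (fun i => setInd (univ.filter fun q : Q 4 3 => ∀ p ∈ N, c p = i → ¬ q ≤ p))) :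
    LiebSahiContinuum 4 3 :=
  SahiGridPattern.liebSahiContinuum_of_patternPos (patternPos_four_of_colouring₃ h)

end OrderThree

end SahiSlot

end Summit.CriticalPhenomena.PercolationContinuityZ3.Theorems
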